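import Summits.Ventures.YMGap.FlowData.TubeStrongCouplingWindow
import Summits.Ventures.YMGap.FlowData.TubeSectorNormLowerBound
import HarnessLib

/-!
# Venture YMGap, track Y3 FLOW-DATA — THE STRONG-COUPLING WINDOW OF EVERY FLUX ENERGY:
# `|E_e(β; (ℤ/L)^k) − |e|·L·(−ln u(β))| ≤ 2β · #plaquettes` for every centre flux `e ∈ ℤ₂^k` (theorems only)

HONEST FRAMING: venture file of the cell `pub-ymgap` (QuantumFields programme), track Y3; THEOREMS about the typed
objects of `FlowData/TorelonEnergy.lean` (`su2FluxEnergy β k L e = log ‖T‖ − log ‖T ∘ P_e‖`; `e = (1,1,0,…)` is the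
FLOW-TABLE's `E₂`, `(1,1,1)` its `E₃`).  Finite tubes only: no number of the FLOW-TABLE, no row, nothing about
`L → ∞`, the continuum or a mass gap.  `|e|` = the number of directions carrying flux
(`(univ.filter (e · = 1)).card`).

* **`su2_tubeSectorNorm_le`** — for `SU(2)` and every `e`: `‖T ∘ P_e‖ ≤ e^{β#P} λ^{|e|L} c₀^{N−|e|L}` (jointly odd
  functions in every flux direction, `TubeOddSymmetrization` + the index-generic `LinkOddBlocksBound`); the matching lower bound
  `e^{−β#P} λ^{|e|L} c₀^{N−|e|L} ≤ ‖T ∘ P_e‖` is `TubeSectorNormLowerBound.tubeSectorNorm_ge` (the staircase path);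
* **`abs_su2FluxEnergy_sub_le`** — `|su2FluxEnergy β k L e − |e|·L·(−ln u(β))| ≤ 2β · #(Plaquette k L)` for EVERY
  `e ∈ ℤ₂^k`, `k`, `L ≥ 1`, `β > 0`: at strong coupling the flux energies are ADDITIVE IN THE FLUX up to `2β` per
  plaquette — `E₂ ≈ 2E₁`, `E₃ ≈ 3E₁` (lattice-staircase values; the FLOW-TABLE's ratio rows `R2 = E₂/E₁` are anchored
  at `2` as `β → 0⁺`); `tendsto_su2FluxEnergy_sub_nhdsWithin_zero`.

References: G. 't Hooft, Nucl. Phys. B 153 (1979) 141 [cite: tHooft1979Flux]; M. Lüscher, Commun. Math. Phys. 54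
(1977) 283 [cite: Luscher1977]; I. Montvay, G. Münster (1994) §3.2.6 [cite: MontvayMunster1994, §3.2.6].
-/

noncomputable section

open scoped BigOperators Topology
open MeasureTheory Filter Function Set Polynomial.Chebyshev
open Literature.MathematicalPhysics.QuantumFieldTheory Literature.MathematicalPhysics.QuantumLattice Literature.Analysis.FunctionSpaces
open Literature.Analysis.OperatorTheory Literature.Barriers.QuantumFields
open Summit.Ventures.LatticeQCDFlow.Exactness Summit.Ventures.LatticeQCDFlow.Scoring
open Summit.Ventures.YMGap.Conjectures (su2CharacterRatio su2CharacterRatio_pos)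

namespace Summit.Ventures.YMGap.FlowData

/-! ### `SU(2)`: the two-sided sector bounds and the window for every flux -/

section SU2

open Literature.MathematicalPhysics.QuantumLattice (fundamentalRep continuous_fundamentalRep fundamentalRep_mem_unitaryGroup)

/-- **`‖T ∘ P_e‖ ≤ e^{β#P} λ^{|e|L} c₀^{N−|e|L}`** for `SU(2)` (fundamental, twist `−1`, `J = β/2`, `β > 0`) and every
flux `e`. [cite: MontvayMunster1994, §3.2.6] -/
theorem su2_tubeSectorNorm_le {β : ℝ} (hβ : 0 < β) (k L : ℕ) [NeZero L] (e : Fin k → ZMod 2) :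
    tubeSectorNorm (fundamentalRep (Fin 2)) su2MinusOne (β / 2) k L e ≤
      Real.exp (β * Fintype.card (Plaquette k L)) *
        (((besselI 1 β - besselI 3 β) / 2) ^ ((Finset.univ.filter fun ν => e ν = 1).card * L) *
          ((besselI 0 β - besselI 2 β) / 1) ^
            (Fintype.card (Edge k L) - (Finset.univ.filter fun ν => e ν = 1).card * L)) := by
  haveI : SecondCountableTopology (Matrix.specialUnitaryGroup (Fin 2) ℂ) :=
    Summit.Ventures.LatticeQCDFlow.Scoring.secondCountableTopology_su2
  set ρ := fundamentalRep (Fin 2) with hρdef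
  set T := tubeTransferOperator ρ (β / 2) k L with hT
  set D : Finset (Fin k) := Finset.univ.filter fun ν => e ν = 1 with hD
  set m : GaugeConfig k L (Matrix.specialUnitaryGroup (Fin 2) ℂ) → ℝ :=
    fun a => Real.exp ((β / 2) / 2 * magSum (d := k) (L := L) ρ a) with hm
  set B : ℝ := ((besselI 1 β - besselI 3 β) / 2) ^ (D.card * L) *
    ((besselI 0 β - besselI 2 β) / 1) ^ (Fintype.card (Edge k L) - D.card * L) with hB
  set Cm : ℝ := Real.exp (|β / 2| * ((2 : ℕ) * Fintype.card (Plaquette k L)) / 2) with hCm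
  have hB0 : 0 ≤ B := SU2Links.oddBlocksBound_nonneg hβ.le _ _
  have hCm0 : 0 < Cm := Real.exp_pos _
  have hCm2 : Cm * Cm = Real.exp (β * Fintype.card (Plaquette k L)) := by
    rw [hCm, ← Real.exp_add, abs_of_pos (half_pos hβ)]
    congr 1; push_cast; ring
  have hmc : Continuous m :=
    Real.continuous_exp.comp (continuous_const.mul (continuous_magSum (d := k) (L := L) ρ (continuous_fundamentalRep (Fin 2))))
  have hmb : ∀ a, |m a| ≤ Cm := fun a => by
    rw [abs_of_pos (Real.exp_pos _)]
    exact exp_half_magSum_le ρ (β / 2) fundamentalRep_mem_unitaryGroup a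
  have hW : ∀ a b : GaugeConfig k L (Matrix.specialUnitaryGroup (Fin 2) ℂ),
      (∏ e : Edge k L, Real.exp (β / 2 * (ρ (b e * (a e)⁻¹)).trace.re)) =
        ∏ e : Edge k L, Real.exp (β * su2a0 (b e * (a e)⁻¹)) := fun a b =>
    Finset.prod_congr rfl fun e _ => by rw [hρdef, su2_weight_eq]; ring_nf
  unfold tubeSectorNorm sectorNorm
  refine ContinuousLinearMap.opNorm_le_bound _ (mul_nonneg (Real.exp_pos _).le hB0) fun ψ => ?_
  rw [ContinuousLinearMap.comp_apply,
    show fluxProjection (fluxTwistOp k L su2MinusOne) e = tubeFluxProjection su2MinusOne k L e from rfl]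
  obtain ⟨g, hTg, hgnorm, hgodd⟩ := exists_jointlyOdd_of_fluxProjection ρ (β / 2)
    (continuous_fundamentalRep (Fin 2)) su2MinusOne_mem_center su2MinusOne_mul_self e ψ
  rw [← hTg]
  set φ := T g with hφ
  have hφinv := tubeTransferOperator_gaugeInvariant_ae ρ (β / 2) (continuous_fundamentalRep (Fin 2))
    fundamentalRep_mem_unitaryGroup g
  have hred := inner_tubeTransferOperator_eq_of_gaugeInvariant ρ (β / 2) (continuous_fundamentalRep (Fin 2))
    fundamentalRep_mem_unitaryGroup φ g hφinv
  simp_rw [hW] at hred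
  have hφm := memLp_two_mul_of_abs_le (Lp.memLp φ) hmc hmb
  have hgm := memLp_two_mul_of_abs_le (Lp.memLp g) hmc hmb
  have hmg : MemLp (fun b => m b * (g : GaugeConfig k L (Matrix.specialUnitaryGroup (Fin 2) ℂ) → ℝ) b) 2
      (sliceMeasure (Matrix.specialUnitaryGroup (Fin 2) ℂ) k L) :=
    hgm.1.ae_eq (Eventually.of_forall fun b => mul_comm _ _)
  have hmg2 : ∫ b, (m b * (g : GaugeConfig k L (Matrix.specialUnitaryGroup (Fin 2) ℂ) → ℝ) b) ^ 2
      ∂(sliceMeasure (Matrix.specialUnitaryGroup (Fin 2) ℂ) k L) ≤ Cm ^ 2 * ‖g‖ ^ 2 := by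
    rw [norm_sq_eq_integral_sq]
    refine le_trans (le_of_eq (integral_congr_ae (Eventually.of_forall fun b =>
      congrArg (fun x : ℝ => x ^ 2) (mul_comm (m b) ((g : GaugeConfig k L (Matrix.specialUnitaryGroup (Fin 2) ℂ) → ℝ) b))))) hgm.2
  have hmg_odd : ∀ μ ∈ D, ∀ s : ZMod L, ∀ᵐ b ∂(sliceMeasure (Matrix.specialUnitaryGroup (Fin 2) ℂ) k L),
      (fun b => m b * (g : GaugeConfig k L (Matrix.specialUnitaryGroup (Fin 2) ℂ) → ℝ) b)
          (fun e' => (if e'.2 = μ ∧ e'.1 μ = s then su2MinusOne else 1) * b e') =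
        -(m b * (g : GaugeConfig k L (Matrix.specialUnitaryGroup (Fin 2) ℂ) → ℝ) b) := by
    intro μ hμ s
    have hμ1 : e μ = 1 := (Finset.mem_filter.1 hμ).2
    filter_upwards [hgodd μ hμ1 s] with b hb
    rw [hb, hm]
    dsimp only
    rw [magSum_hyperplaneFlip ρ su2MinusOne_mem_center su2MinusOne_mul_self μ s b]
    ring
  -- the odd-sector bound of the index-generic chain, blocks = the hyperplanes `x_μ = s`, `μ ∈ D`, `s ∈ ℤ/L`
  have hcardS : Fintype.card {p : Fin k × ZMod L // p.1 ∈ D} = D.card * L := by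
    rw [Fintype.card_subtype]
    have h : (Finset.univ.filter fun p : Fin k × ZMod L => p.1 ∈ D) = D ×ˢ (Finset.univ : Finset (ZMod L)) := by
      ext p
      simp only [Finset.mem_filter, Finset.mem_univ, true_and, Finset.mem_product, and_true]
    rw [h, Finset.card_product, Finset.card_univ, ZMod.card]
  have hcore' := SU2Links.abs_integral_mul_integral_weight_mul_le_of_odd_blocks (ι := Edge k L)
    (S := {p : Fin k × ZMod L // p.1 ∈ D}) hβ
    (fun (p : {p : Fin k × ZMod L // p.1 ∈ D}) (e' : Edge k L) => e'.2 = p.1.1 ∧ e'.1 p.1.1 = p.1.2)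
    (fun p p' e' hp hp' => Subtype.ext (Prod.ext (hp.1.symm.trans hp'.1)
      (by rw [← hp.2, hp.1.symm.trans hp'.1, hp'.2])))
    hφm.1 hmg (fun p => hmg_odd p.1.1 p.2 p.1.2)
  rw [hcardS] at hcore'
  have hcore : |∫ a, ((φ : GaugeConfig k L (Matrix.specialUnitaryGroup (Fin 2) ℂ) → ℝ) a * m a) *
        ∫ b, (∏ e' : Edge k L, Real.exp (β * su2a0 (b e' * (a e')⁻¹))) *
          (m b * (g : GaugeConfig k L (Matrix.specialUnitaryGroup (Fin 2) ℂ) → ℝ) b)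
          ∂(sliceMeasure (Matrix.specialUnitaryGroup (Fin 2) ℂ) k L)
          ∂(sliceMeasure (Matrix.specialUnitaryGroup (Fin 2) ℂ) k L)| ≤
      B * (Real.sqrt (∫ a, ((φ : GaugeConfig k L (Matrix.specialUnitaryGroup (Fin 2) ℂ) → ℝ) a * m a) ^ 2
              ∂(sliceMeasure (Matrix.specialUnitaryGroup (Fin 2) ℂ) k L)) *
            Real.sqrt (∫ b, (m b * (g : GaugeConfig k L (Matrix.specialUnitaryGroup (Fin 2) ℂ) → ℝ) b) ^ 2
              ∂(sliceMeasure (Matrix.specialUnitaryGroup (Fin 2) ℂ) k L))) := by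
    rw [hB]
    exact hcore'
  have hsq : ‖φ‖ ^ 2 ≤ B * ((Cm * ‖φ‖) * (Cm * ‖g‖)) := by
    have hx : Real.sqrt (∫ a, ((φ : GaugeConfig k L (Matrix.specialUnitaryGroup (Fin 2) ℂ) → ℝ) a * m a) ^ 2
        ∂(sliceMeasure (Matrix.specialUnitaryGroup (Fin 2) ℂ) k L)) ≤ Cm * ‖φ‖ := by
      refine (Real.sqrt_le_sqrt hφm.2).trans (le_of_eq ?_)
      rw [← norm_sq_eq_integral_sq, ← mul_pow, Real.sqrt_sq (mul_nonneg hCm0.le (norm_nonneg _))]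
    have hy : Real.sqrt (∫ b, (m b * (g : GaugeConfig k L (Matrix.specialUnitaryGroup (Fin 2) ℂ) → ℝ) b) ^ 2
        ∂(sliceMeasure (Matrix.specialUnitaryGroup (Fin 2) ℂ) k L)) ≤ Cm * ‖g‖ := by
      refine (Real.sqrt_le_sqrt hmg2).trans (le_of_eq ?_)
      rw [← mul_pow, Real.sqrt_sq (mul_nonneg hCm0.le (norm_nonneg _))]
    calc ‖φ‖ ^ 2 = @inner ℝ _ _ φ (T g) := by rw [← hφ, real_inner_self_eq_norm_sq]
      _ = ∫ a, ((φ : GaugeConfig k L (Matrix.specialUnitaryGroup (Fin 2) ℂ) → ℝ) a * m a) *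
            ∫ b, (∏ e : Edge k L, Real.exp (β * su2a0 (b e * (a e)⁻¹))) *
              (m b * (g : GaugeConfig k L (Matrix.specialUnitaryGroup (Fin 2) ℂ) → ℝ) b)
              ∂(sliceMeasure (Matrix.specialUnitaryGroup (Fin 2) ℂ) k L)
              ∂(sliceMeasure (Matrix.specialUnitaryGroup (Fin 2) ℂ) k L) := hred
      _ ≤ _ := le_abs_self _
      _ ≤ B * (Real.sqrt (∫ a, ((φ : GaugeConfig k L (Matrix.specialUnitaryGroup (Fin 2) ℂ) → ℝ) a * m a) ^ 2
              ∂(sliceMeasure (Matrix.specialUnitaryGroup (Fin 2) ℂ) k L)) *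
            Real.sqrt (∫ b, (m b * (g : GaugeConfig k L (Matrix.specialUnitaryGroup (Fin 2) ℂ) → ℝ) b) ^ 2
              ∂(sliceMeasure (Matrix.specialUnitaryGroup (Fin 2) ℂ) k L))) := hcore
      _ ≤ B * ((Cm * ‖φ‖) * (Cm * ‖g‖)) :=
          mul_le_mul_of_nonneg_left (mul_le_mul hx hy (Real.sqrt_nonneg _) (mul_nonneg hCm0.le (norm_nonneg _))) hB0
  have hφle : ‖φ‖ ≤ Real.exp (β * Fintype.card (Plaquette k L)) * B * ‖g‖ := by
    by_cases h0 : ‖φ‖ = 0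
    · rw [h0]; exact mul_nonneg (mul_nonneg (Real.exp_pos _).le hB0) (norm_nonneg _)
    · have hpos : 0 < ‖φ‖ := lt_of_le_of_ne (norm_nonneg _) (Ne.symm h0)
      have h2 : ‖φ‖ * ‖φ‖ ≤ (Real.exp (β * Fintype.card (Plaquette k L)) * B * ‖g‖) * ‖φ‖ := by
        rw [← sq, ← hCm2]
        calc ‖φ‖ ^ 2 ≤ B * ((Cm * ‖φ‖) * (Cm * ‖g‖)) := hsq
          _ = Cm * Cm * B * ‖g‖ * ‖φ‖ := by ring
      exact le_of_mul_le_mul_right h2 hpos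
  calc ‖T g‖ = ‖φ‖ := rfl
    _ ≤ Real.exp (β * Fintype.card (Plaquette k L)) * B * ‖g‖ := hφle
    _ ≤ Real.exp (β * Fintype.card (Plaquette k L)) * B * ‖ψ‖ :=
        mul_le_mul_of_nonneg_left hgnorm (mul_nonneg (Real.exp_pos _).le hB0)
    _ = _ := by rw [hB, mul_assoc]

/-- **THE STRONG-COUPLING WINDOW OF EVERY FLUX ENERGY.**  On every tube `(ℤ/L)^k`, every flux `e ∈ ℤ₂^k`, every
`β > 0`: `|su2FluxEnergy β k L e − |e| · L · (−ln u(β))| ≤ 2β · #(Plaquette k L)` — the flux energies are additive in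
the number `|e|` of flux-carrying directions up to `2β` per spatial plaquette (`E₂ ≈ 2E₁`, `E₃ ≈ 3E₁` at strong
coupling, on every finite tube). [cite: MontvayMunster1994, §3.2.6] [cite: tHooft1979Flux] -/
theorem abs_su2FluxEnergy_sub_le {β : ℝ} (hβ : 0 < β) (k L : ℕ) [NeZero L] (e : Fin k → ZMod 2) :
    |su2FluxEnergy β k L e -
        ((Finset.univ.filter fun ν => e ν = 1).card : ℝ) * L * (-Real.log (su2CharacterRatio β))| ≤
      2 * β * Fintype.card (Plaquette k L) := by
  haveI : SecondCountableTopology (Matrix.specialUnitaryGroup (Fin 2) ℂ) :=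
    Summit.Ventures.LatticeQCDFlow.Scoring.secondCountableTopology_su2
  set P : ℝ := (Fintype.card (Plaquette k L) : ℝ) with hP
  set N : ℕ := Fintype.card (Edge k L) with hN
  set r : ℕ := (Finset.univ.filter fun ν => e ν = 1).card with hr
  set c0 : ℝ := ∫ U : Matrix.specialUnitaryGroup (Fin 2) ℂ, Real.exp (β * su2a0 U)
    ∂haarProbability (Matrix.specialUnitaryGroup (Fin 2) ℂ) with hc0
  set lam : ℝ := ∫ U : Matrix.specialUnitaryGroup (Fin 2) ℂ, Real.exp (β * su2a0 U) * su2a0 U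
    ∂haarProbability (Matrix.specialUnitaryGroup (Fin 2) ℂ) with hlam
  have hc0' : (∫ g : Matrix.specialUnitaryGroup (Fin 2) ℂ, Real.exp (β / 2 * ((fundamentalRep (Fin 2) g).trace).re)
      ∂haarProbability (Matrix.specialUnitaryGroup (Fin 2) ℂ)) = c0 :=
    integral_congr_ae (Eventually.of_forall fun U => by simp only [su2_weight_eq]; ring_nf)
  have hlam' : (∫ U : Matrix.specialUnitaryGroup (Fin 2) ℂ, Real.exp (2 * (β / 2) * su2a0 U) * su2a0 U
      ∂haarProbability (Matrix.specialUnitaryGroup (Fin 2) ℂ)) = lam := by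
    rw [show 2 * (β / 2) = β by ring]
  have hu : lam / c0 = su2CharacterRatio β := by
    have h := su2_schurScalar_div_weightMass (β / 2)
    rw [show 2 * (β / 2) = β by ring] at h
    exact h
  have hc0pos : 0 < c0 := by
    have h := su2_weightMass_pos (β / 2)
    rwa [show 2 * (β / 2) = β by ring] at h
  have hupos : 0 < su2CharacterRatio β := su2CharacterRatio_pos hβ
  have hlampos : 0 < lam := by
    have h := div_mul_cancel₀ lam hc0pos.ne'
    rw [hu] at h
    rw [← h]
    exact mul_pos hupos hc0pos
  have hc0B : (besselI 0 β - besselI 2 β) / 1 = c0 := (integral_exp_su2a0_eq_besselISub hβ.le).symm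
  have hlamB : (besselI 1 β - besselI 3 β) / 2 = lam := (integral_exp_mul_su2a0_eq_besselISub hβ.le).symm
  have hrN : r * L ≤ N := card_support_mul_le_card_edge (k := k) (L := L) e
  have hJ : |β / 2| * ((2 : ℕ) * (Fintype.card (Plaquette k L) : ℝ)) = β * P := by
    rw [abs_of_pos (half_pos hβ)]; push_cast; ring
  -- the four norm bounds
  have hTge : Real.exp (-(β * P)) * c0 ^ N ≤ ‖tubeTransferOperator (fundamentalRep (Fin 2)) (β / 2) k L‖ := by
    have h := norm_tubeTransferOperator_ge (fundamentalRep (Fin 2)) (β / 2) (k := k) (L := L)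
      (continuous_fundamentalRep (Fin 2)) fundamentalRep_mem_unitaryGroup two_ne_zero (su2_integral_exp_mul_apply (β / 2))
    rwa [hc0', hJ] at h
  have hTle : ‖tubeTransferOperator (fundamentalRep (Fin 2)) (β / 2) k L‖ ≤ Real.exp (β * P) * c0 ^ N := by
    have h := norm_tubeTransferOperator_le (fundamentalRep (Fin 2)) (β / 2) (k := k) (L := L)
      (continuous_fundamentalRep (Fin 2)) fundamentalRep_mem_unitaryGroup
    rwa [hc0', hJ] at h
  have hSle : tubeSectorNorm (fundamentalRep (Fin 2)) su2MinusOne (β / 2) k L e ≤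
      Real.exp (β * P) * (lam ^ (r * L) * c0 ^ (N - r * L)) := by
    have h := su2_tubeSectorNorm_le hβ k L e
    rwa [hc0B, hlamB] at h
  have hSge : Real.exp (-(β * P)) * (c0 ^ (N - r * L) * lam ^ (r * L)) ≤
      tubeSectorNorm (fundamentalRep (Fin 2)) su2MinusOne (β / 2) k L e := by
    have h := tubeSectorNorm_ge (fundamentalRep (Fin 2)) (β / 2) (k := k) (L := L) (continuous_fundamentalRep (Fin 2))
      fundamentalRep_mem_unitaryGroup two_ne_zero su2MinusOne_mem_center fundamentalRep_su2MinusOne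
      (su2_integral_exp_mul_apply (β / 2)) e
    rwa [hc0', hlam', hJ] at h
  -- logarithms
  have hTpos : 0 < ‖tubeTransferOperator (fundamentalRep (Fin 2)) (β / 2) k L‖ :=
    lt_of_lt_of_le (mul_pos (Real.exp_pos _) (pow_pos hc0pos _)) hTge
  have hSpos : 0 < tubeSectorNorm (fundamentalRep (Fin 2)) su2MinusOne (β / 2) k L e :=
    lt_of_lt_of_le (mul_pos (Real.exp_pos _) (mul_pos (pow_pos hc0pos _) (pow_pos hlampos _))) hSge
  have h1 : -(β * P) + (N : ℝ) * Real.log c0 ≤ Real.log ‖tubeTransferOperator (fundamentalRep (Fin 2)) (β / 2) k L‖ := by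
    have h := Real.log_le_log (mul_pos (Real.exp_pos _) (pow_pos hc0pos _)) hTge
    rwa [Real.log_mul (Real.exp_pos _).ne' (pow_pos hc0pos _).ne', Real.log_exp, Real.log_pow] at h
  have h1' : Real.log ‖tubeTransferOperator (fundamentalRep (Fin 2)) (β / 2) k L‖ ≤ β * P + (N : ℝ) * Real.log c0 := by
    have h := Real.log_le_log hTpos hTle
    rwa [Real.log_mul (Real.exp_pos _).ne' (pow_pos hc0pos _).ne', Real.log_exp, Real.log_pow] at h
  have h2 : Real.log (tubeSectorNorm (fundamentalRep (Fin 2)) su2MinusOne (β / 2) k L e) ≤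
      β * P + (((r * L : ℕ) : ℝ) * Real.log lam + ((N - r * L : ℕ) : ℝ) * Real.log c0) := by
    have h := Real.log_le_log hSpos hSle
    rwa [Real.log_mul (Real.exp_pos _).ne' (mul_pos (pow_pos hlampos _) (pow_pos hc0pos _)).ne', Real.log_exp,
      Real.log_mul (pow_pos hlampos _).ne' (pow_pos hc0pos _).ne', Real.log_pow, Real.log_pow] at h
  have h2' : -(β * P) + (((N - r * L : ℕ) : ℝ) * Real.log c0 + ((r * L : ℕ) : ℝ) * Real.log lam) ≤
      Real.log (tubeSectorNorm (fundamentalRep (Fin 2)) su2MinusOne (β / 2) k L e) := by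
    have h := Real.log_le_log (mul_pos (Real.exp_pos _) (mul_pos (pow_pos hc0pos _) (pow_pos hlampos _))) hSge
    rwa [Real.log_mul (Real.exp_pos _).ne' (mul_pos (pow_pos hc0pos _) (pow_pos hlampos _)).ne', Real.log_exp,
      Real.log_mul (pow_pos hc0pos _).ne' (pow_pos hlampos _).ne', Real.log_pow, Real.log_pow] at h
  have hcast : (((N - r * L : ℕ) : ℝ)) = (N : ℝ) - ((r * L : ℕ) : ℝ) := by rw [Nat.cast_sub hrN]
  rw [hcast] at h2 h2'
  have hcast2 : ((r * L : ℕ) : ℝ) = (r : ℝ) * L := by push_cast; ring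
  rw [hcast2] at h2 h2'
  have key : Real.log c0 - Real.log lam = -Real.log (su2CharacterRatio β) := by
    rw [← neg_sub, ← Real.log_div hlampos.ne' hc0pos.ne', hu]
  unfold su2FluxEnergy tubeFluxEnergy fluxEnergy
  rw [show sectorNorm (tubeTransferOperator (fundamentalRep (Fin 2)) (β / 2) k L) (fluxTwistOp k L su2MinusOne) e =
      tubeSectorNorm (fundamentalRep (Fin 2)) su2MinusOne (β / 2) k L e from rfl]
  have h3 : (r : ℝ) * L * (-Real.log (su2CharacterRatio β)) = (r : ℝ) * L * Real.log c0 - (r : ℝ) * L * Real.log lam := by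
    rw [← key]; ring
  rw [h3, abs_sub_le_iff]
  constructor <;> linarith

/-- **Additivity in the flux is the strong-coupling asymptote**: `su2FluxEnergy β k L e − |e|·L·(−ln u(β)) → 0` as
`β → 0⁺`, for every flux `e` on every tube. [cite: MontvayMunster1994, §3.2.6] -/
theorem tendsto_su2FluxEnergy_sub_nhdsWithin_zero (k L : ℕ) [NeZero L] (e : Fin k → ZMod 2) :
    Tendsto (fun β : ℝ => su2FluxEnergy β k L e -
        ((Finset.univ.filter fun ν => e ν = 1).card : ℝ) * L * (-Real.log (su2CharacterRatio β)))
      (𝓝[>] (0 : ℝ)) (𝓝 0) := by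
  have hb : Tendsto (fun β : ℝ => 2 * β * Fintype.card (Plaquette k L)) (𝓝[>] (0 : ℝ)) (𝓝 0) := by
    have h : Tendsto (fun β : ℝ => 2 * β * Fintype.card (Plaquette k L)) (𝓝 (0 : ℝ))
        (𝓝 (2 * 0 * Fintype.card (Plaquette k L))) :=
      ((continuous_const.mul continuous_id).mul continuous_const).tendsto 0
    rw [mul_zero, zero_mul] at h
    exact h.mono_left nhdsWithin_le_nhds
  refine squeeze_zero_norm' ?_ hb
  filter_upwards [self_mem_nhdsWithin] with β hβ
  rw [Real.norm_eq_abs]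
  exact abs_su2FluxEnergy_sub_le hβ k L e

end SU2

end Summit.Ventures.YMGap.FlowData
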